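import Literature.NumberTheory.EllipticCurves.HeegnerFieldOfDiscriminantProofs
import Literature.NumberTheory.EllipticCurves.AnalyticRank
import Literature.NumberTheory.EllipticCurves.QuadraticTwist
import Literature.NumberTheory.QuadraticFields.ImaginaryQuadraticClassNumberValues
import HarnessLib

set_option linter.dupNamespace false -- `Summit.BirchSwinnertonDyer.BirchSwinnertonDyer.Theorems.…` (summit = sub, D-0017)
set_option autoImplicit false

/-!
# Crux `HeegnerTwistCouplingInSupply` (stmt-BirchSwinnertonDyer-21381) — the EXACT-CLASS-NUMBER door and the CORE rows
# beyond the size bulk `h(K′) < p`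

Route `BiquadraticEisensteinDescent` (cell `pub/bsd-wall`; width seat `bsd-wall-cm-bed-w1` g17; theorems only, `--supports 21381`).

The conclusion of the crux for a pair `(W, p)` is `∃ K′` imaginary quadratic with `4 < |d_{K′}|`, the Heegner hypothesis for
`N_W`, `L(W^{(d_{K′})}, 1) ≠ 0` and `p ∤ h(K′)`.  The line lead's corner theorems (`…IndefinitePinCorner`, `…PartnerLadder`, …)
obtain `p ∤ h(K′)` from the SIZE BULK `h(K′) < p`.  On the CORE census (72 pairs `(class, p)`, `N < 2·10⁴`, bsd-wall-cm g11
`KS-INSTANCE-TABLE-21381-g11.md`) the size bulk is EMPTY for 21 pairs — every `j = 0` pair at `p = 5` whose conductor is divisible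
by `30` (`N ∈ {900, 2700, 3600, 10800, 14400}`: the least Heegner discriminants are `−71` with `h = 7` and `−191` with `h = 13`),
`14112x1 @ 7` (`−167`, `h = 11`) and `4356b1, 13068c1 @ 11` (`−239`, `h = 15`) — as the ideation seat cruxidea-21381-1 g22 recorded
(`Cruxes/HeegnerTwistCouplingInSupply/OBSTRUCTIONS-seat1-g22.md` §0.3 / §2.6: «discharge the p = 5, 7 CORE rows by exact form class
numbers (in-tree) rather than the empty h < p bulk»).

This file supplies the door that replaces `h(K′) < p` by a KERNEL VALUE of `h(K′)`:

* §1 `exists_heegnerField_classNumber_eq` — for a negative square-free `d ≡ 1 (mod 8)` (resp. `d ≡ 1 (mod 4)` at an odd level) whose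
  Jacobi symbol is `+1` at every odd prime of the level `N`, the field `K′ = ℚ(√d)` (`sqrtField d`) is imaginary quadratic of
  discriminant `d`, Heegner for `N`, and `h(K′)` EQUALS the kernel value `BinQF.classNumber d` (Cox Thm. 2.13 + Thm. 7.7(ii), tree theorems
  `isImaginaryQuadratic_and_discr_sqrtField_of_squarefree_natAbs`, `satisfiesHeegnerHypothesis_sqrtField_of_squarefree_natAbs`,
  `ClassNumberValues.classNumber_eq_of_discr_eq`); `cruxConclusion_of_witness` — the conclusion of the crux for `(W, p)` from ONE such
  `d` with `p ∤ BinQF.classNumber d`, modulo the single `L`-input `L(W^{(d)}, 1) ≠ 0` (per-curve; NOT proved here).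
* §2 the three conductor supports of the 21 pairs: primes of `N` in `{2, 3, 5}` ⟹ witnesses `d = −71` (`h = 7`) and `d = −191`
  (`h = 13`); in `{2, 3, 7}` ⟹ `d = −167` (`h = 11`) and `d = −47` (`h = 5`); in `{2, 3, 11}` ⟹ `d = −239` (`h = 15`) and `d = −95`
  (`h = 8`).  All Jacobi symbols by `norm_num`, all class numbers by the kernel values of `ImaginaryQuadraticClassNumberValues`.
* §3 the row theorems: for every `W` whose conductor has prime support in `{2,3,5}` (resp. `{2,3,7}`, `{2,3,11}`) and every prime `p`
  not dividing the displayed class number, `L(W^{(d)}, 1) ≠ 0` ⟹ the conclusion of the crux at `(W, p)`; in particular the 21 CORE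
  pairs above at `p = 5, 7, 11` (modulo their `L`-inputs, which the census certifies numerically — Heegner indices `m ≠ 0` — but which are
  not tree theorems).

HONEST FRAMING: instance layer only (single curves / conductor supports are null families); nothing here touches C⁺
(`stub_nonNullIndivisibleHeegner`), the crux as stated, or BSD.  No definition, no named fact, no `sorry`; axioms standard.
[cite: Cox2013, §2.A Thm. 2.13; §7.B Thm. 7.7(ii)] [cite: GrossLMS1991, §1] [cite: Marcus2018, Ch. 3 Thm. 25]
-/

namespace Summit.BirchSwinnertonDyer.BirchSwinnertonDyer.Theorems.BiquadraticEisensteinDescentHeegnerTwistCouplingInSupplyExactClassNumberDoor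

open Literature.NumberTheory.EllipticCurves Literature.NumberTheory.QuadraticFields
  Literature.NumberTheory.QuadraticFields.Quadratic

/-! ## §1 The door -/

/-- **Heegner witness field with its EXACT class number (even or odd level).** For a negative `d ≡ 1 (mod 8)`, square-free,
with `(d/ℓ) = 1` at every odd prime `ℓ ∣ N`: `K′ = ℚ(√d)` is imaginary quadratic, `d_{K′} = d`, Heegner for `N`, and
`h(K′) = h(d)` (the kernel value `BinQF.classNumber d`). [cite: Cox2013, §7.B Thm. 7.7(ii)] [cite: GrossLMS1991, §1] -/
theorem exists_heegnerField_classNumber_eq {d : ℤ} (hd : d < 0) (hd8 : d % 8 = 1) (hsf : Squarefree d.natAbs)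
    {h : ℕ} (hh : BinQF.classNumber d = h) {N : ℕ}
    (hN : ∀ ℓ : ℕ, ℓ.Prime → ℓ ∣ N → ℓ = 2 ∨ jacobiSym d ℓ = 1) :
    ∃ (K : Type) (_ : Field K) (_ : NumberField K),
      IsImaginaryQuadratic K ∧ NumberField.discr K = d ∧ SatisfiesHeegnerHypothesis N K ∧
        NumberField.classNumber K = h := by
  haveI : Fact (d < 0) := ⟨hd⟩
  obtain ⟨hK, hdK⟩ := isImaginaryQuadratic_and_discr_sqrtField_of_squarefree_natAbs d (by omega) hsf
  exact ⟨sqrtField d, inferInstance, inferInstance, hK, hdK,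
    satisfiesHeegnerHypothesis_sqrtField_of_squarefree_natAbs d hd8 hsf hN,
    ClassNumberValues.classNumber_eq_of_discr_eq hK.1 hdK hd hh⟩

/-- **Heegner witness field with its EXACT class number, odd level.** For a negative `d ≡ 1 (mod 4)`, square-free, with
`(d/ℓ) = 1` at every prime `ℓ` of the ODD level `N`: `K′ = ℚ(√d)` is imaginary quadratic, `d_{K′} = d`, Heegner for `N`,
`h(K′) = h(d)`. [cite: Cox2013, §7.B Thm. 7.7(ii)] [cite: GrossLMS1991, §1] -/
theorem exists_heegnerField_classNumber_eq_of_odd {d : ℤ} (hd : d < 0) (hd4 : d % 4 = 1) (hsf : Squarefree d.natAbs)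
    {h : ℕ} (hh : BinQF.classNumber d = h) {N : ℕ} (hN2 : ¬ 2 ∣ N)
    (hN : ∀ ℓ : ℕ, ℓ.Prime → ℓ ∣ N → jacobiSym d ℓ = 1) :
    ∃ (K : Type) (_ : Field K) (_ : NumberField K),
      IsImaginaryQuadratic K ∧ NumberField.discr K = d ∧ SatisfiesHeegnerHypothesis N K ∧
        NumberField.classNumber K = h := by
  haveI : Fact (d < 0) := ⟨hd⟩
  obtain ⟨hK, hdK⟩ := isImaginaryQuadratic_and_discr_sqrtField_of_squarefree_natAbs d hd4 hsf
  exact ⟨sqrtField d, inferInstance, inferInstance, hK, hdK,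
    satisfiesHeegnerHypothesis_sqrtField_of_odd d hd4 (Int.squarefree_natAbs.mp hsf) hN2 hN,
    ClassNumberValues.classNumber_eq_of_discr_eq hK.1 hdK hd hh⟩

/-- **The exact-class-number door to the conclusion of crux 21381.** For ANY `W / ℚ` and prime `p`: one negative square-free
`d ≡ 1 (mod 8)` with `4 < |d|`, `(d/ℓ) = 1` at the odd primes of `N_W`, a kernel value `h(d)` with `p ∤ h(d)`, and the `L`-input
`L(W^{(d)}, 1) ≠ 0` give a Heegner field `K′` of `N_W` with `4 < |d_{K′}|`, `L(W^{(d_{K′})}, 1) ≠ 0`, `h(K′) = h(d)` and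
`p ∤ h(K′)` — the conclusion of `HeegnerTwistCouplingInSupply` at `(W, p)` with the class number DISPLAYED. The `L`-input is a
hypothesis (per-curve datum), not proved here. [cite: Cox2013, §7.B Thm. 7.7(ii)] [cite: GrossLMS1991, §1] -/
theorem cruxConclusion_of_witness (W : WeierstrassCurve ℚ) (p : ℕ) {d : ℤ} (hd : d < 0) (hd8 : d % 8 = 1)
    (hsf : Squarefree d.natAbs) (h4 : 4 < d.natAbs) {h : ℕ} (hh : BinQF.classNumber d = h) (hph : ¬ p ∣ h)
    (hN : ∀ ℓ : ℕ, ℓ.Prime → ℓ ∣ W.conductorNorm ℤ → ℓ = 2 ∨ jacobiSym d ℓ = 1)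
    (hL : (W.quadraticTwist (d : ℚ)).entireLFunction 1 ≠ 0) :
    ∃ (K : Type) (_ : Field K) (_ : NumberField K),
      IsImaginaryQuadratic K ∧ 4 < (NumberField.discr K).natAbs ∧ SatisfiesHeegnerHypothesis (W.conductorNorm ℤ) K ∧
        (W.quadraticTwist (NumberField.discr K : ℚ)).entireLFunction 1 ≠ 0 ∧
          NumberField.classNumber K = h ∧ ¬ p ∣ NumberField.classNumber K := by
  obtain ⟨K, _, _, hK, hdK, hH, hcl⟩ := exists_heegnerField_classNumber_eq hd hd8 hsf hh hN
  refine ⟨K, inferInstance, inferInstance, hK, ?_, hH, ?_, hcl, ?_⟩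
  · rw [hdK]; exact h4
  · rw [hdK]; exact hL
  · rw [hcl]; exact hph

/-- **The door at an odd level** (`d ≡ 1 (mod 4)` suffices). [cite: Cox2013, §7.B Thm. 7.7(ii)] [cite: GrossLMS1991, §1] -/
theorem cruxConclusion_of_witness_of_odd (W : WeierstrassCurve ℚ) (p : ℕ) {d : ℤ} (hd : d < 0) (hd4 : d % 4 = 1)
    (hsf : Squarefree d.natAbs) (h4 : 4 < d.natAbs) {h : ℕ} (hh : BinQF.classNumber d = h) (hph : ¬ p ∣ h)
    (hN2 : ¬ 2 ∣ W.conductorNorm ℤ) (hN : ∀ ℓ : ℕ, ℓ.Prime → ℓ ∣ W.conductorNorm ℤ → jacobiSym d ℓ = 1)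
    (hL : (W.quadraticTwist (d : ℚ)).entireLFunction 1 ≠ 0) :
    ∃ (K : Type) (_ : Field K) (_ : NumberField K),
      IsImaginaryQuadratic K ∧ 4 < (NumberField.discr K).natAbs ∧ SatisfiesHeegnerHypothesis (W.conductorNorm ℤ) K ∧
        (W.quadraticTwist (NumberField.discr K : ℚ)).entireLFunction 1 ≠ 0 ∧
          NumberField.classNumber K = h ∧ ¬ p ∣ NumberField.classNumber K := by
  obtain ⟨K, _, _, hK, hdK, hH, hcl⟩ := exists_heegnerField_classNumber_eq_of_odd hd hd4 hsf hh hN2 hN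
  refine ⟨K, inferInstance, inferInstance, hK, ?_, hH, ?_, hcl, ?_⟩
  · rw [hdK]; exact h4
  · rw [hdK]; exact hL
  · rw [hcl]; exact hph

/-! ## §2 Conductor supports and witness discriminants -/

/-- A prime dividing `2^a · 3^b · q^c` is `2`, `3` or `q`. [folklore] -/
theorem eq_of_prime_dvd_pow_mul_pow_mul_pow {ℓ q a b c : ℕ} (hℓ : ℓ.Prime) (hq : q.Prime)
    (h : ℓ ∣ 2 ^ a * 3 ^ b * q ^ c) : ℓ = 2 ∨ ℓ = 3 ∨ ℓ = q := by
  rcases (Nat.Prime.dvd_mul hℓ).mp h with h23 | h5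
  · rcases (Nat.Prime.dvd_mul hℓ).mp h23 with h2 | h3
    · exact Or.inl ((Nat.prime_dvd_prime_iff_eq hℓ Nat.prime_two).mp (hℓ.dvd_of_dvd_pow h2))
    · exact Or.inr (Or.inl ((Nat.prime_dvd_prime_iff_eq hℓ Nat.prime_three).mp (hℓ.dvd_of_dvd_pow h3)))
  · exact Or.inr (Or.inr ((Nat.prime_dvd_prime_iff_eq hℓ hq).mp (hℓ.dvd_of_dvd_pow h5)))

/-- The CORE conductors at `p = 5` with `30 ∣ N` have prime support `{2, 3, 5}`:
`900 = 2²3²5²`, `2700 = 2²3³5²`, `3600 = 2⁴3²5²`, `10800 = 2⁴3³5²`, `14400 = 2⁶3²5²` (and `6400 = 2⁸5²`). [folklore] -/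
theorem support_235 {N : ℕ} (hN : N = 900 ∨ N = 2700 ∨ N = 3600 ∨ N = 10800 ∨ N = 14400 ∨ N = 6400) :
    ∀ ℓ : ℕ, ℓ.Prime → ℓ ∣ N → ℓ = 2 ∨ ℓ = 3 ∨ ℓ = 5 := by
  intro ℓ hℓ hℓN
  have h5 : Nat.Prime 5 := by norm_num
  rcases hN with rfl | rfl | rfl | rfl | rfl | rfl
  · exact eq_of_prime_dvd_pow_mul_pow_mul_pow (a := 2) (b := 2) (c := 2) hℓ h5 (by norm_num at hℓN ⊢; exact hℓN)
  · exact eq_of_prime_dvd_pow_mul_pow_mul_pow (a := 2) (b := 3) (c := 2) hℓ h5 (by norm_num at hℓN ⊢; exact hℓN)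
  · exact eq_of_prime_dvd_pow_mul_pow_mul_pow (a := 4) (b := 2) (c := 2) hℓ h5 (by norm_num at hℓN ⊢; exact hℓN)
  · exact eq_of_prime_dvd_pow_mul_pow_mul_pow (a := 4) (b := 3) (c := 2) hℓ h5 (by norm_num at hℓN ⊢; exact hℓN)
  · exact eq_of_prime_dvd_pow_mul_pow_mul_pow (a := 6) (b := 2) (c := 2) hℓ h5 (by norm_num at hℓN ⊢; exact hℓN)
  · exact eq_of_prime_dvd_pow_mul_pow_mul_pow (a := 8) (b := 0) (c := 2) hℓ h5 (by norm_num at hℓN ⊢; exact hℓN)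

/-- The CORE conductors at `p = 7` have prime support in `{2, 3, 7}`: `1568 = 2⁵7²`, `3136 = 2⁶7²`, `12544 = 2⁸7²`,
`14112 = 2⁵3²7²`. [folklore] -/
theorem support_237 {N : ℕ} (hN : N = 1568 ∨ N = 3136 ∨ N = 12544 ∨ N = 14112) :
    ∀ ℓ : ℕ, ℓ.Prime → ℓ ∣ N → ℓ = 2 ∨ ℓ = 3 ∨ ℓ = 7 := by
  intro ℓ hℓ hℓN
  have h7 : Nat.Prime 7 := by norm_num
  rcases hN with rfl | rfl | rfl | rfl
  · exact eq_of_prime_dvd_pow_mul_pow_mul_pow (a := 5) (b := 0) (c := 2) hℓ h7 (by norm_num at hℓN ⊢; exact hℓN)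
  · exact eq_of_prime_dvd_pow_mul_pow_mul_pow (a := 6) (b := 0) (c := 2) hℓ h7 (by norm_num at hℓN ⊢; exact hℓN)
  · exact eq_of_prime_dvd_pow_mul_pow_mul_pow (a := 8) (b := 0) (c := 2) hℓ h7 (by norm_num at hℓN ⊢; exact hℓN)
  · exact eq_of_prime_dvd_pow_mul_pow_mul_pow (a := 5) (b := 2) (c := 2) hℓ h7 (by norm_num at hℓN ⊢; exact hℓN)

/-- The CORE conductors at `p = 11` have prime support in `{2, 3, 11}`: `3267 = 3³11²`, `3872 = 2⁵11²`, `4356 = 2²3²11²`,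
`7744 = 2⁶11²`, `13068 = 2²3³11²`, `17424 = 2⁴3²11²`. [folklore] -/
theorem support_2311 {N : ℕ} (hN : N = 3267 ∨ N = 3872 ∨ N = 4356 ∨ N = 7744 ∨ N = 13068 ∨ N = 17424) :
    ∀ ℓ : ℕ, ℓ.Prime → ℓ ∣ N → ℓ = 2 ∨ ℓ = 3 ∨ ℓ = 11 := by
  intro ℓ hℓ hℓN
  have h11 : Nat.Prime 11 := by norm_num
  rcases hN with rfl | rfl | rfl | rfl | rfl | rfl
  · exact eq_of_prime_dvd_pow_mul_pow_mul_pow (a := 0) (b := 3) (c := 2) hℓ h11 (by norm_num at hℓN ⊢; exact hℓN)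
  · exact eq_of_prime_dvd_pow_mul_pow_mul_pow (a := 5) (b := 0) (c := 2) hℓ h11 (by norm_num at hℓN ⊢; exact hℓN)
  · exact eq_of_prime_dvd_pow_mul_pow_mul_pow (a := 2) (b := 2) (c := 2) hℓ h11 (by norm_num at hℓN ⊢; exact hℓN)
  · exact eq_of_prime_dvd_pow_mul_pow_mul_pow (a := 6) (b := 0) (c := 2) hℓ h11 (by norm_num at hℓN ⊢; exact hℓN)
  · exact eq_of_prime_dvd_pow_mul_pow_mul_pow (a := 2) (b := 3) (c := 2) hℓ h11 (by norm_num at hℓN ⊢; exact hℓN)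
  · exact eq_of_prime_dvd_pow_mul_pow_mul_pow (a := 4) (b := 2) (c := 2) hℓ h11 (by norm_num at hℓN ⊢; exact hℓN)

/-- `−q` is square-free in the `ℕ`-form for a prime `q`. [folklore] -/
theorem squarefree_natAbs_neg_prime {q : ℕ} (hq : q.Prime) : Squarefree (-(q : ℤ)).natAbs := by
  rw [Int.natAbs_neg, Int.natAbs_natCast]
  exact hq.squarefree

/-- `95 = 5 · 19` is square-free (in the `ℕ`-form of `−95`). [folklore] -/
theorem squarefree_natAbs_neg95 : Squarefree (-(95 : ℤ)).natAbs := by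
  rw [show (-(95 : ℤ)).natAbs = 5 * 19 by rfl, Nat.squarefree_mul (by norm_num)]
  exact ⟨(by norm_num : Nat.Prime 5).squarefree, (by norm_num : Nat.Prime 19).squarefree⟩

/-- **Support `{2, 3, 5}`, witness `d = −71`** (`−71 ≡ 1 (mod 8)`, `(−71/3) = (−71/5) = +1`). [folklore] -/
theorem jacobi_neg71 {ℓ : ℕ} (h : ℓ = 2 ∨ ℓ = 3 ∨ ℓ = 5) : ℓ = 2 ∨ jacobiSym (-71) ℓ = 1 := by
  rcases h with rfl | rfl | rfl
  · exact Or.inl rfl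
  · right; norm_num
  · right; norm_num

/-- **Support `{2, 3, 5}`, witness `d = −191`** (`−191 ≡ 1 (mod 8)`, `(−191/3) = (−191/5) = +1`). [folklore] -/
theorem jacobi_neg191 {ℓ : ℕ} (h : ℓ = 2 ∨ ℓ = 3 ∨ ℓ = 5) : ℓ = 2 ∨ jacobiSym (-191) ℓ = 1 := by
  rcases h with rfl | rfl | rfl
  · exact Or.inl rfl
  · right; norm_num
  · right; norm_num

/-- **Support `{2, 3, 7}`, witness `d = −167`** (`−167 ≡ 1 (mod 8)`, `(−167/3) = (−167/7) = +1`). [folklore] -/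
theorem jacobi_neg167 {ℓ : ℕ} (h : ℓ = 2 ∨ ℓ = 3 ∨ ℓ = 7) : ℓ = 2 ∨ jacobiSym (-167) ℓ = 1 := by
  rcases h with rfl | rfl | rfl
  · exact Or.inl rfl
  · right; norm_num
  · right; norm_num

/-- **Support `{2, 3, 7}`, witness `d = −47`** (`−47 ≡ 1 (mod 8)`, `(−47/3) = (−47/7) = +1`). [folklore] -/
theorem jacobi_neg47 {ℓ : ℕ} (h : ℓ = 2 ∨ ℓ = 3 ∨ ℓ = 7) : ℓ = 2 ∨ jacobiSym (-47) ℓ = 1 := by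
  rcases h with rfl | rfl | rfl
  · exact Or.inl rfl
  · right; norm_num
  · right; norm_num

/-- **Support `{2, 3, 11}`, witness `d = −239`** (`−239 ≡ 1 (mod 8)`, `(−239/3) = (−239/11) = +1`). [folklore] -/
theorem jacobi_neg239 {ℓ : ℕ} (h : ℓ = 2 ∨ ℓ = 3 ∨ ℓ = 11) : ℓ = 2 ∨ jacobiSym (-239) ℓ = 1 := by
  rcases h with rfl | rfl | rfl
  · exact Or.inl rfl
  · right; norm_num
  · right; norm_num

/-- **Support `{2, 3, 11}`, witness `d = −95`** (`−95 ≡ 1 (mod 8)`, `(−95/3) = (−95/11) = +1`). [folklore] -/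
theorem jacobi_neg95 {ℓ : ℕ} (h : ℓ = 2 ∨ ℓ = 3 ∨ ℓ = 11) : ℓ = 2 ∨ jacobiSym (-95) ℓ = 1 := by
  rcases h with rfl | rfl | rfl
  · exact Or.inl rfl
  · right; norm_num
  · right; norm_num

/-- **Odd support `{3, 5, 7}`, witness `d = −59`** (`(−59/3) = (−59/5) = (−59/7) = +1`). [folklore] -/
theorem jacobi_neg59 {ℓ : ℕ} (h : ℓ = 3 ∨ ℓ = 5 ∨ ℓ = 7) : jacobiSym (-59) ℓ = 1 := by
  rcases h with rfl | rfl | rfl <;> norm_num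

/-- **Odd support `{3, 5}`, witness `d = −11`** (`(−11/3) = (−11/5) = +1`). [folklore] -/
theorem jacobi_neg11 {ℓ : ℕ} (h : ℓ = 3 ∨ ℓ = 5) : jacobiSym (-11) ℓ = 1 := by
  rcases h with rfl | rfl <;> norm_num

/-! ## §3 The rows: conclusion of crux 21381 at `(W, p)` modulo the one `L`-input -/

/-- **Support `{2,3,5}` via `K′ = ℚ(√−71)`, `h(K′) = 7`.** For every `W / ℚ` whose conductor has prime support in `{2, 3, 5}`
and every `p` with `p ∤ 7`: `L(W^{(−71)}, 1) ≠ 0` ⟹ the conclusion of crux 21381 at `(W, p)`, with `h(K′) = 7` displayed.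
Covers the 15 CORE pairs `900c1, 2700h1/l1/p1, 3600bd1/be1, 10800cr1/cv1/cz1/di1/dl1, 14400a1/df1/dm1/l1/m1 @ 5` (size bulk
EMPTY) and `6400f1 @ 5`, each modulo its own `L`-input. [cite: Cox2013, §7.B Thm. 7.7(ii)] [cite: GrossLMS1991, §1] -/
theorem row_support235_neg71 (W : WeierstrassCurve ℚ) (p : ℕ) (hp : ¬ p ∣ 7)
    (hN : ∀ ℓ : ℕ, ℓ.Prime → ℓ ∣ W.conductorNorm ℤ → ℓ = 2 ∨ ℓ = 3 ∨ ℓ = 5)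
    (hL : (W.quadraticTwist ((-71 : ℤ) : ℚ)).entireLFunction 1 ≠ 0) :
    ∃ (K : Type) (_ : Field K) (_ : NumberField K),
      IsImaginaryQuadratic K ∧ 4 < (NumberField.discr K).natAbs ∧ SatisfiesHeegnerHypothesis (W.conductorNorm ℤ) K ∧
        (W.quadraticTwist (NumberField.discr K : ℚ)).entireLFunction 1 ≠ 0 ∧
          NumberField.classNumber K = 7 ∧ ¬ p ∣ NumberField.classNumber K :=
  cruxConclusion_of_witness W p (by norm_num) (by norm_num) (squarefree_natAbs_neg_prime (by norm_num)) (by norm_num)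
    ClassNumberValues.classNumber_neg71 hp (fun ℓ hℓ hℓN => jacobi_neg71 (hN ℓ hℓ hℓN)) hL

/-- **Support `{2,3,5}` via `K′ = ℚ(√−191)`, `h(K′) = 13`** (the second witness of the `30 ∣ N` rows; `p ∤ 13`).
[cite: Cox2013, §7.B Thm. 7.7(ii)] [cite: GrossLMS1991, §1] -/
theorem row_support235_neg191 (W : WeierstrassCurve ℚ) (p : ℕ) (hp : ¬ p ∣ 13)
    (hN : ∀ ℓ : ℕ, ℓ.Prime → ℓ ∣ W.conductorNorm ℤ → ℓ = 2 ∨ ℓ = 3 ∨ ℓ = 5)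
    (hL : (W.quadraticTwist ((-191 : ℤ) : ℚ)).entireLFunction 1 ≠ 0) :
    ∃ (K : Type) (_ : Field K) (_ : NumberField K),
      IsImaginaryQuadratic K ∧ 4 < (NumberField.discr K).natAbs ∧ SatisfiesHeegnerHypothesis (W.conductorNorm ℤ) K ∧
        (W.quadraticTwist (NumberField.discr K : ℚ)).entireLFunction 1 ≠ 0 ∧
          NumberField.classNumber K = 13 ∧ ¬ p ∣ NumberField.classNumber K :=
  cruxConclusion_of_witness W p (by norm_num) (by norm_num) (squarefree_natAbs_neg_prime (by norm_num)) (by norm_num)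
    ClassNumberValues.classNumber_neg191 hp (fun ℓ hℓ hℓN => jacobi_neg191 (hN ℓ hℓ hℓN)) hL

/-- **Support `{2,3,7}` via `K′ = ℚ(√−167)`, `h(K′) = 11`** (`p ∤ 11`). Covers the CORE pair `14112x1 @ 7` (size bulk EMPTY:
its least good Heegner field is `ℚ(√−167)`), modulo its `L`-input. [cite: Cox2013, §7.B Thm. 7.7(ii)] [cite: GrossLMS1991, §1] -/
theorem row_support237_neg167 (W : WeierstrassCurve ℚ) (p : ℕ) (hp : ¬ p ∣ 11)
    (hN : ∀ ℓ : ℕ, ℓ.Prime → ℓ ∣ W.conductorNorm ℤ → ℓ = 2 ∨ ℓ = 3 ∨ ℓ = 7)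
    (hL : (W.quadraticTwist ((-167 : ℤ) : ℚ)).entireLFunction 1 ≠ 0) :
    ∃ (K : Type) (_ : Field K) (_ : NumberField K),
      IsImaginaryQuadratic K ∧ 4 < (NumberField.discr K).natAbs ∧ SatisfiesHeegnerHypothesis (W.conductorNorm ℤ) K ∧
        (W.quadraticTwist (NumberField.discr K : ℚ)).entireLFunction 1 ≠ 0 ∧
          NumberField.classNumber K = 11 ∧ ¬ p ∣ NumberField.classNumber K :=
  cruxConclusion_of_witness W p (by norm_num) (by norm_num) (squarefree_natAbs_neg_prime (by norm_num)) (by norm_num)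
    ClassNumberValues.classNumber_neg167 hp (fun ℓ hℓ hℓN => jacobi_neg167 (hN ℓ hℓ hℓN)) hL

/-- **Support `{2,3,7}` via `K′ = ℚ(√−47)`, `h(K′) = 5`** (`p ∤ 5`; the size-bulk witness of `1568g1, 3136t1/u1/v1,
12544i1/j1/k1/o1, 14112bj1/bk1/bn1 @ 7`). [cite: Cox2013, §7.B Thm. 7.7(ii)] [cite: GrossLMS1991, §1] -/
theorem row_support237_neg47 (W : WeierstrassCurve ℚ) (p : ℕ) (hp : ¬ p ∣ 5)
    (hN : ∀ ℓ : ℕ, ℓ.Prime → ℓ ∣ W.conductorNorm ℤ → ℓ = 2 ∨ ℓ = 3 ∨ ℓ = 7)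
    (hL : (W.quadraticTwist ((-47 : ℤ) : ℚ)).entireLFunction 1 ≠ 0) :
    ∃ (K : Type) (_ : Field K) (_ : NumberField K),
      IsImaginaryQuadratic K ∧ 4 < (NumberField.discr K).natAbs ∧ SatisfiesHeegnerHypothesis (W.conductorNorm ℤ) K ∧
        (W.quadraticTwist (NumberField.discr K : ℚ)).entireLFunction 1 ≠ 0 ∧
          NumberField.classNumber K = 5 ∧ ¬ p ∣ NumberField.classNumber K :=
  cruxConclusion_of_witness W p (by norm_num) (by norm_num) (squarefree_natAbs_neg_prime (by norm_num)) (by norm_num)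
    ClassNumberValues.classNumber_neg47 hp (fun ℓ hℓ hℓN => jacobi_neg47 (hN ℓ hℓ hℓN)) hL

/-- **Support `{2,3,11}` via `K′ = ℚ(√−239)`, `h(K′) = 15`** (`p ∤ 15`). Covers the CORE pairs `4356b1, 13068c1 @ 11` (size bulk
EMPTY), modulo their `L`-inputs. [cite: Cox2013, §7.B Thm. 7.7(ii)] [cite: GrossLMS1991, §1] -/
theorem row_support2311_neg239 (W : WeierstrassCurve ℚ) (p : ℕ) (hp : ¬ p ∣ 15)
    (hN : ∀ ℓ : ℕ, ℓ.Prime → ℓ ∣ W.conductorNorm ℤ → ℓ = 2 ∨ ℓ = 3 ∨ ℓ = 11)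
    (hL : (W.quadraticTwist ((-239 : ℤ) : ℚ)).entireLFunction 1 ≠ 0) :
    ∃ (K : Type) (_ : Field K) (_ : NumberField K),
      IsImaginaryQuadratic K ∧ 4 < (NumberField.discr K).natAbs ∧ SatisfiesHeegnerHypothesis (W.conductorNorm ℤ) K ∧
        (W.quadraticTwist (NumberField.discr K : ℚ)).entireLFunction 1 ≠ 0 ∧
          NumberField.classNumber K = 15 ∧ ¬ p ∣ NumberField.classNumber K :=
  cruxConclusion_of_witness W p (by norm_num) (by norm_num) (squarefree_natAbs_neg_prime (by norm_num)) (by norm_num)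
    ClassNumberValues.classNumber_neg239 hp (fun ℓ hℓ hℓN => jacobi_neg239 (hN ℓ hℓ hℓN)) hL

/-- **Support `{2,3,11}` via `K′ = ℚ(√−95)`, `h(K′) = 8`** (`p ∤ 8`; the size-bulk witness of `4356a1/c1, 13068b1/d1,
17424ba1/bb1/be1/bf1 @ 11`). [cite: Cox2013, §7.B Thm. 7.7(ii)] [cite: GrossLMS1991, §1] -/
theorem row_support2311_neg95 (W : WeierstrassCurve ℚ) (p : ℕ) (hp : ¬ p ∣ 8)
    (hN : ∀ ℓ : ℕ, ℓ.Prime → ℓ ∣ W.conductorNorm ℤ → ℓ = 2 ∨ ℓ = 3 ∨ ℓ = 11)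
    (hL : (W.quadraticTwist ((-95 : ℤ) : ℚ)).entireLFunction 1 ≠ 0) :
    ∃ (K : Type) (_ : Field K) (_ : NumberField K),
      IsImaginaryQuadratic K ∧ 4 < (NumberField.discr K).natAbs ∧ SatisfiesHeegnerHypothesis (W.conductorNorm ℤ) K ∧
        (W.quadraticTwist (NumberField.discr K : ℚ)).entireLFunction 1 ≠ 0 ∧
          NumberField.classNumber K = 8 ∧ ¬ p ∣ NumberField.classNumber K :=
  cruxConclusion_of_witness W p (by norm_num) (by norm_num) squarefree_natAbs_neg95 (by norm_num)
    ClassNumberValues.classNumber_neg95 hp (fun ℓ hℓ hℓN => jacobi_neg95 (hN ℓ hℓ hℓN)) hL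

/-- **Odd support `{3,5,7}` via `K′ = ℚ(√−59)`, `h(K′) = 3`** (`p ∤ 3`; witness for `11025a1/b1/k1/l1/y1 @ 5`, also for the odd
`{3,5}`-conductors). [cite: Cox2013, §7.B Thm. 7.7(ii)] [cite: GrossLMS1991, §1] -/
theorem row_support357_neg59 (W : WeierstrassCurve ℚ) (p : ℕ) (hp : ¬ p ∣ 3) (hN2 : ¬ 2 ∣ W.conductorNorm ℤ)
    (hN : ∀ ℓ : ℕ, ℓ.Prime → ℓ ∣ W.conductorNorm ℤ → ℓ = 3 ∨ ℓ = 5 ∨ ℓ = 7)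
    (hL : (W.quadraticTwist ((-59 : ℤ) : ℚ)).entireLFunction 1 ≠ 0) :
    ∃ (K : Type) (_ : Field K) (_ : NumberField K),
      IsImaginaryQuadratic K ∧ 4 < (NumberField.discr K).natAbs ∧ SatisfiesHeegnerHypothesis (W.conductorNorm ℤ) K ∧
        (W.quadraticTwist (NumberField.discr K : ℚ)).entireLFunction 1 ≠ 0 ∧
          NumberField.classNumber K = 3 ∧ ¬ p ∣ NumberField.classNumber K :=
  cruxConclusion_of_witness_of_odd W p (by norm_num) (by norm_num) (squarefree_natAbs_neg_prime (by norm_num)) (by norm_num)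
    ClassNumberValues.classNumber_neg59 hp hN2 (fun ℓ hℓ hℓN => jacobi_neg59 (hN ℓ hℓ hℓN)) hL

/-- **Odd support `{3,5}` via `K′ = ℚ(√−11)`, `h(K′) = 1`** — EVERY `p` (witness for `225a1, 675a1, 6075a1/b1/bc1/bd1/c1 @ 5`).
[cite: Cox2013, §7.B Thm. 7.7(ii)] [cite: GrossLMS1991, §1] -/
theorem row_support35_neg11 (W : WeierstrassCurve ℚ) (p : ℕ) (hp : p ≠ 1) (hN2 : ¬ 2 ∣ W.conductorNorm ℤ)
    (hN : ∀ ℓ : ℕ, ℓ.Prime → ℓ ∣ W.conductorNorm ℤ → ℓ = 3 ∨ ℓ = 5)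
    (hL : (W.quadraticTwist ((-11 : ℤ) : ℚ)).entireLFunction 1 ≠ 0) :
    ∃ (K : Type) (_ : Field K) (_ : NumberField K),
      IsImaginaryQuadratic K ∧ 4 < (NumberField.discr K).natAbs ∧ SatisfiesHeegnerHypothesis (W.conductorNorm ℤ) K ∧
        (W.quadraticTwist (NumberField.discr K : ℚ)).entireLFunction 1 ≠ 0 ∧
          NumberField.classNumber K = 1 ∧ ¬ p ∣ NumberField.classNumber K :=
  cruxConclusion_of_witness_of_odd W p (by norm_num) (by norm_num) (squarefree_natAbs_neg_prime (by norm_num)) (by norm_num)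
    ClassNumberValues.classNumber_neg11 (fun h => hp (Nat.dvd_one.mp h)) hN2 (fun ℓ hℓ hℓN => jacobi_neg11 (hN ℓ hℓ hℓN)) hL

/-- **The 15 CORE pairs at `p = 5` with `30 ∣ N` (size bulk EMPTY)**: for `W` of conductor `900, 2700, 3600, 10800, 14400`
(or `6400`), `L(W^{(−71)}, 1) ≠ 0` ⟹ the conclusion of crux 21381 at `(W, 5)` through `K′ = ℚ(√−71)`, `h(K′) = 7`, `5 ∤ 7`.
[cite: Cox2013, §7.B Thm. 7.7(ii)] [cite: GrossLMS1991, §1] -/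
theorem core_rows_at_five_neg71 (W : WeierstrassCurve ℚ)
    (hW : W.conductorNorm ℤ = 900 ∨ W.conductorNorm ℤ = 2700 ∨ W.conductorNorm ℤ = 3600 ∨ W.conductorNorm ℤ = 10800 ∨
      W.conductorNorm ℤ = 14400 ∨ W.conductorNorm ℤ = 6400)
    (hL : (W.quadraticTwist ((-71 : ℤ) : ℚ)).entireLFunction 1 ≠ 0) :
    ∃ (K : Type) (_ : Field K) (_ : NumberField K),
      IsImaginaryQuadratic K ∧ 4 < (NumberField.discr K).natAbs ∧ SatisfiesHeegnerHypothesis (W.conductorNorm ℤ) K ∧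
        (W.quadraticTwist (NumberField.discr K : ℚ)).entireLFunction 1 ≠ 0 ∧
          NumberField.classNumber K = 7 ∧ ¬ 5 ∣ NumberField.classNumber K :=
  row_support235_neg71 W 5 (by norm_num) (support_235 hW) hL

/-- **The same 15 pairs through the second witness `K′ = ℚ(√−191)`, `h(K′) = 13`, `5 ∤ 13`** (for the rows whose census
record is `−191`: `900c1, 2700h1/l1, 3600be1, 14400df1`). [cite: Cox2013, §7.B Thm. 7.7(ii)] [cite: GrossLMS1991, §1] -/
theorem core_rows_at_five_neg191 (W : WeierstrassCurve ℚ)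
    (hW : W.conductorNorm ℤ = 900 ∨ W.conductorNorm ℤ = 2700 ∨ W.conductorNorm ℤ = 3600 ∨ W.conductorNorm ℤ = 10800 ∨
      W.conductorNorm ℤ = 14400 ∨ W.conductorNorm ℤ = 6400)
    (hL : (W.quadraticTwist ((-191 : ℤ) : ℚ)).entireLFunction 1 ≠ 0) :
    ∃ (K : Type) (_ : Field K) (_ : NumberField K),
      IsImaginaryQuadratic K ∧ 4 < (NumberField.discr K).natAbs ∧ SatisfiesHeegnerHypothesis (W.conductorNorm ℤ) K ∧
        (W.quadraticTwist (NumberField.discr K : ℚ)).entireLFunction 1 ≠ 0 ∧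
          NumberField.classNumber K = 13 ∧ ¬ 5 ∣ NumberField.classNumber K :=
  row_support235_neg191 W 5 (by norm_num) (support_235 hW) hL

/-- **The CORE pair `14112x1 @ 7` (and every conductor `1568, 3136, 12544, 14112` at `p = 7`)** through `K′ = ℚ(√−167)`,
`h(K′) = 11`, `7 ∤ 11`, modulo the `L`-input. [cite: Cox2013, §7.B Thm. 7.7(ii)] [cite: GrossLMS1991, §1] -/
theorem core_rows_at_seven_neg167 (W : WeierstrassCurve ℚ)
    (hW : W.conductorNorm ℤ = 1568 ∨ W.conductorNorm ℤ = 3136 ∨ W.conductorNorm ℤ = 12544 ∨ W.conductorNorm ℤ = 14112)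
    (hL : (W.quadraticTwist ((-167 : ℤ) : ℚ)).entireLFunction 1 ≠ 0) :
    ∃ (K : Type) (_ : Field K) (_ : NumberField K),
      IsImaginaryQuadratic K ∧ 4 < (NumberField.discr K).natAbs ∧ SatisfiesHeegnerHypothesis (W.conductorNorm ℤ) K ∧
        (W.quadraticTwist (NumberField.discr K : ℚ)).entireLFunction 1 ≠ 0 ∧
          NumberField.classNumber K = 11 ∧ ¬ 7 ∣ NumberField.classNumber K :=
  row_support237_neg167 W 7 (by norm_num) (support_237 hW) hL

/-- **The CORE pairs `4356b1, 13068c1 @ 11` (and every conductor `3267, 3872, 4356, 7744, 13068, 17424` at `p = 11`)** through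
`K′ = ℚ(√−239)`, `h(K′) = 15`, `11 ∤ 15`, modulo the `L`-input. [cite: Cox2013, §7.B Thm. 7.7(ii)] [cite: GrossLMS1991, §1] -/
theorem core_rows_at_eleven_neg239 (W : WeierstrassCurve ℚ)
    (hW : W.conductorNorm ℤ = 3267 ∨ W.conductorNorm ℤ = 3872 ∨ W.conductorNorm ℤ = 4356 ∨ W.conductorNorm ℤ = 7744 ∨
      W.conductorNorm ℤ = 13068 ∨ W.conductorNorm ℤ = 17424)
    (hL : (W.quadraticTwist ((-239 : ℤ) : ℚ)).entireLFunction 1 ≠ 0) :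
    ∃ (K : Type) (_ : Field K) (_ : NumberField K),
      IsImaginaryQuadratic K ∧ 4 < (NumberField.discr K).natAbs ∧ SatisfiesHeegnerHypothesis (W.conductorNorm ℤ) K ∧
        (W.quadraticTwist (NumberField.discr K : ℚ)).entireLFunction 1 ≠ 0 ∧
          NumberField.classNumber K = 15 ∧ ¬ 11 ∣ NumberField.classNumber K :=
  row_support2311_neg239 W 11 (by norm_num) (support_2311 hW) hL

end Summit.BirchSwinnertonDyer.BirchSwinnertonDyer.Theorems.BiquadraticEisensteinDescentHeegnerTwistCouplingInSupplyExactClassNumberDoor
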